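import Literature.AlgebraicGeometry.Motives.UniversalHypersurfaceRegularLocusChartPartial
import Literature.AlgebraicGeometry.Motives.UniversalHypersurfaceRegularLocusChartFunction
import Literature.AlgebraicGeometry.Motives.UniversalHypersurfaceRegularLocusSubmersion
import Literature.AlgebraicGeometry.Motives.UniversalHypersurfaceRegularLocusTopology
import Literature.Geometry.Manifold.SubmersionLiftVectorField
import HarnessLib

/-!
# Lifting vector fields of the space of forms to `𝒴°(ℂ)`, tangent to the level sets of a chart function along a closed set

Family `hodge`, layer `Literature/AlgebraicGeometry/Motives`; the instantiation of the tangent-lift lemma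
`Geometry/Manifold/SubmersionLiftVectorField.exists_contMDiff_lift_vectorField_tangent` on the complex manifold `𝒴°(ℂ)` of the regular locus
of the universal hypersurface: the coefficient map `g = (b_m)_m : 𝒴°(ℂ) → ℂ^N` is a `C^∞` submersion (`UniversalHypersurfaceRegularLocusSubmersion`),
`𝒴°(ℂ)` is a Hausdorff σ-compact `C^∞` manifold (`UniversalHypersurfaceRegularLocusTopology`), and the auxiliary function is a chart function
`ρ = regChartExtend n d i B` (`UniversalHypersurfaceRegularLocusChartFunction`). Result:

* `exists_contMDiff_lift_tangent_regChartExtend` — **for a `C^∞` vector field `W` on `ℂ^N`, a `C^∞` function `B` of the chart coordinates with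
  bounded affine support, and a closed `K ⊆ 𝒴°(ℂ)` on which `(g, ρ)` has onto differential, there is a `C^∞` vector field `X` on `𝒴°(ℂ)` with
  `dg(X) = W ∘ g` everywhere and `dρ(X) = 0` on `K`.**

For the nodal pencil the hypothesis on `K` is `HodgeTheory/CyclicCoverPencilJointSubmersion`; the fields `X` (for `W` the two constant fields of
the moving coefficient, cut off to a disc) are the raw material of the fold isotopy of the degeneration programme
(`HodgeTheory/CyclicCoverNodalMeridianLocalMonodromyBound`). Everything is proved; no definitions, no named facts.

## References

* [BrockerJanichIDT1982] T. Bröcker, K. Jänich, Introduction to Differential Topology (1982), (8.12) (lifting the basic fields).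
* [ArnoldGuseinzadeVarchenko2012] V. I. Arnold, S. M. Gusein-Zade, A. N. Varchenko, Singularities of Differentiable Maps II (2012), Part I §1.1, §2.1.
-/

noncomputable section

open CategoryTheory AlgebraicGeometry TopologicalSpace Set Topology
open scoped Manifold ContDiff
open Literature.Geometry.Manifold

namespace Literature.AlgebraicGeometry.Motives.UniversalHypersurface

variable (n d : ℕ) (i : Fin (n + 2))

/-- **Tangent lift on `𝒴°(ℂ)`.** For `d ≥ 1`, a `C^∞` field `W` on `ℂ^{DegIndex n d}`, a `C^∞` real function `B` of the chart coordinates of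
`𝒴°(ℂ)ᵢ` vanishing for `‖y‖ > R`, and a closed `K ⊆ 𝒴°(ℂ)` on which `Q ↦ (b(Q), regChartExtend n d i B Q)` has onto differential, there is a
`C^∞` vector field `X` on `𝒴°(ℂ)` with `db(X) = W(b)` everywhere and `d(regChartExtend B)(X) = 0` on `K`.
[cite: BrockerJanichIDT1982, (8.12)] [cite: ArnoldGuseinzadeVarchenko2012, Part I §2.1] -/
theorem exists_contMDiff_lift_tangent_regChartExtend (hd : 0 < d)
    {W : (DegIndex n d → ℂ) → (DegIndex n d → ℂ)} (hW : ContDiff ℝ ∞ W)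
    (B : (ChartIdx n d i → ℂ) → ℝ) (hB : ContDiff ℝ ∞ B) {R : ℝ} (hBR : ∀ v, R < ‖fun j => v (Sum.inr j)‖ → B v = 0)
    {K : Set (ComplexPoints (regularTotal ℂ n d))} (hK : IsClosed K)
    (hsurj₂ : haveI := locallyOfFiniteType_regularTotal_hom ℂ n d hd
      haveI := smoothOfRelativeDimension_regularTotal_hom ℂ n d hd
      letI := ComplexPoints.chartedSpace (regularTotal ℂ n d) (n + Fintype.card (DegIndex n d))
      ∀ Q ∈ K, Function.Surjective (mfderiv (𝓡 (2 * (n + Fintype.card (DegIndex n d)))) 𝓘(ℝ, (DegIndex n d → ℂ) × ℝ)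
        (fun Q' => (regCoeff ℂ n d Q', regChartExtend n d i B Q')) Q)) :
    haveI := locallyOfFiniteType_regularTotal_hom ℂ n d hd
    haveI := smoothOfRelativeDimension_regularTotal_hom ℂ n d hd
    letI := ComplexPoints.chartedSpace (regularTotal ℂ n d) (n + Fintype.card (DegIndex n d))
    haveI := ComplexPoints.isManifold_real (regularTotal ℂ n d) (n + Fintype.card (DegIndex n d))
    ∃ X : Π Q : ComplexPoints (regularTotal ℂ n d), TangentSpace (𝓡 (2 * (n + Fintype.card (DegIndex n d)))) Q,
      ContMDiff (𝓡 (2 * (n + Fintype.card (DegIndex n d)))) (𝓡 (2 * (n + Fintype.card (DegIndex n d)))).tangent ∞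
        (fun Q => (⟨Q, X Q⟩ : TangentBundle (𝓡 (2 * (n + Fintype.card (DegIndex n d)))) (ComplexPoints (regularTotal ℂ n d)))) ∧
      (∀ Q, mfderiv (𝓡 (2 * (n + Fintype.card (DegIndex n d)))) 𝓘(ℝ, DegIndex n d → ℂ) (fun Q' => regCoeff ℂ n d Q') Q (X Q) =
        W (regCoeff ℂ n d Q)) ∧
      ∀ Q ∈ K, mfderiv (𝓡 (2 * (n + Fintype.card (DegIndex n d)))) 𝓘(ℝ, ℝ) (regChartExtend n d i B) Q (X Q) = 0 := by
  haveI := locallyOfFiniteType_regularTotal_hom ℂ n d hd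
  haveI := smoothOfRelativeDimension_regularTotal_hom ℂ n d hd
  letI := ComplexPoints.chartedSpace (regularTotal ℂ n d) (n + Fintype.card (DegIndex n d))
  haveI := ComplexPoints.isManifold_real (regularTotal ℂ n d) (n + Fintype.card (DegIndex n d))
  haveI := t2Space_regularTotal n d
  haveI := sigmaCompactSpace_regularTotal n d hd
  have hg : ContMDiff (𝓡 (2 * (n + Fintype.card (DegIndex n d)))) 𝓘(ℝ, DegIndex n d → ℂ) ∞ (fun Q' => regCoeff ℂ n d Q') :=
    fun Q => contMDiffAt_regCoeff n d hd Q
  have hsurj : ∀ Q, Function.Surjective (mfderiv (𝓡 (2 * (n + Fintype.card (DegIndex n d)))) 𝓘(ℝ, DegIndex n d → ℂ)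
      (fun Q' => regCoeff ℂ n d Q') Q) := fun Q => surjective_mfderiv_regCoeff n d hd Q
  have hρ : ContMDiff (𝓡 (2 * (n + Fintype.card (DegIndex n d)))) 𝓘(ℝ, ℝ) ∞ (regChartExtend n d i B) :=
    contMDiff_regChartExtend n d i hd B hB hBR
  exact exists_contMDiff_lift_vectorField_tangent (I := 𝓡 (2 * (n + Fintype.card (DegIndex n d)))) hg hsurj hW hρ hK hsurj₂

end Literature.AlgebraicGeometry.Motives.UniversalHypersurface

end
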